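import Literature.NumberTheory.EllipticCurves.Sprung2012.HondaLevelTwoRelationsProofs
import HarnessLib

/-!
# Sketch (stub-ideation k4 g24, family 3 «assume the opposite», event-armed on p715086) —
# the QUANTIFIER DOMAIN of the relay's `hMT` (`hERL_of_mazurTateValues` p715086, `…_at` p715483): «∀ Honda datum admitted by `π.hcol`»

Crux `ResidualThetaCountLowerPureAtTwo` (stmt-26074), stub `stub_cmLambdaLower` = RSL_g (22608), interior I1 of the
k-lane. Theorems only, no `sorry`, no new definitions, no instances. BSD is proved for no curve by any of this.

§1 OPPOSITE «every admissible Honda datum is formal» is FALSE: the six conjuncts of `OnePairPins.hcol` (generator,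
   layers, traces, non-divisibility, congruences (5), pinning (6)) are invariant under the constant shift
   `dH ↦ dH + η` by any `η ∈ E(K_v)` with `(p+1) • η = 0` (tree currency, any `p`; at `p = 2`: `η ∈ W(ℚ_v)[3]`,
   non-zero since `#W̃(𝔽₂) = 3`), and such a shift leaves any torsion-free «formal» subgroup.
§2 RIGIDITY: two data admitted by the SAME column have coefficientwise EQUAL pairing sums (Weierstrass: the landed
   `Sprung2012.eq_zero_of_toIwasawa_cyclotomicOmega_dvd_sum`), so `hMT`-∀ is `hMT` at the hidden datum.
§3 The MTV-level TRANSFER algebra (torsor bypass): congruence pairs along two data and columns `col' = u·col` give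
   `ω ∣ P' − u·P`; pushed through a `Λ`-semilinear `e`; and the cleared-form Mazur–Tate congruence moves from one datum to
   the other with the unit `w ↦ w·U` at the SAME named multiplier `μt` (the `_at` form) — no inverse, no formal-group
   membership of the handed datum needed.
§4 Toy certificates (`decide`/`rfl`).
-/

set_option autoImplicit false

namespace Summit.BirchSwinnertonDyer.BirchSwinnertonDyer.Cruxes.ResidualThetaCountLowerPureAtTwo.SideaK4G24

open Polynomial Finset
open Literature.NumberTheory.EllipticCurves Literature.NumberTheory.GaloisRepresentations ZpExtension
open Literature.NumberTheory.EllipticCurves.Kobayashi2003 Literature.NumberTheory.EllipticCurves.Sprung2012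
open Literature.NumberTheory.EllipticCurves.Sprung2017

universe u

/-! ## §1 The `(p+1)`-torsion shift of an admissible Honda datum -/

section Shift

variable {K : Type u} [Field K] {p : ℕ} [Fact p.Prime] (κ : ZpExtension K p)
variable {E : Type u} [Field E] [Algebra K E] (ι : AlgebraicClosure K →ₐ[K] AlgebraicClosure E)
variable (W : WeierstrassCurve K)

/-- In a domain of characteristic zero such as `ℤ_p`, `(p+1) • r = 0` forces `r = 0`. [folklore] -/
theorem eq_zero_of_succ_nsmul_eq_zero_padicInt {r : ℤ_[p]} (h : (p + 1) • r = 0) : r = 0 := by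
  rw [nsmul_eq_mul] at h
  rcases mul_eq_zero.mp h with h0 | h0
  · exact absurd h0 (by exact_mod_cast Nat.succ_ne_zero p)
  · exact h0

/-- A `ℤ_p`-valued additive functional kills `(p+1)`-torsion. [folklore] -/
theorem apply_eq_zero_of_succ_nsmul_eq_zero {M : Type*} [AddCommGroup M] (z : M →+ ℤ_[p]) {η : M}
    (hη : (p + 1) • η = 0) : z η = 0 :=
  eq_zero_of_succ_nsmul_eq_zero_padicInt (p := p) (by rw [← map_nsmul, hη, map_zero])

/-- (hlay) is shift-invariant: `dH m + η ∈ E(K_m·E)` for `η ∈ E(K_0·E) = E(E)`. [cite: Kobayashi2003, Def. 1.1] -/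
theorem shift_mem_localLayerPointsOfEmb {dH : ℕ → localPoints W E} {η : localPoints W E}
    (hd : ∀ m, dH m ∈ localLayerPointsOfEmb κ ι W m) (hη : η ∈ localLayerPointsOfEmb κ ι W 0) (m : ℕ) :
    dH m + η ∈ localLayerPointsOfEmb κ ι W m :=
  add_mem (hd m) (localLayerPointsOfEmb_mono κ ι W (Nat.zero_le m) hη)

/-- The relative trace `Tr_{m+2/m+1}` multiplies a point of the BASE by `p` (the local layer degrees are `p^n` once
`Γ_E` holds a lift of the topological generator — `index_localLayerSubgroupOfEmb_eq_pow_of_isTopGenerator`).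
[cite: Kobayashi2003, Def. 1.1] [cite: Sprung2012, Lemma 2.3] -/
theorem localTraceOfEmb_succ_succ_of_mem_zero {g : Field.absoluteGaloisGroup E} (hg : κ.IsTopGenerator (resGalOfEmb ι g))
    {η : localPoints W E} (hη : η ∈ localLayerPointsOfEmb κ ι W 0) (m : ℕ) :
    localTraceOfEmb κ ι W (m + 1) (m + 2) η = p • η := by
  rw [localTraceOfEmb_apply_of_mem_lower κ ι W (m + 1) (m + 2)
    (localLayerPointsOfEmb_mono κ ι W (Nat.zero_le _) hη)]
  change (localLayerSubgroupOfEmb κ ι (m + 2)).relIndex (localLayerSubgroupOfEmb κ ι (m + 1)) • η = p • η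
  congr 1
  have hle : localLayerSubgroupOfEmb κ ι (m + 2) ≤ localLayerSubgroupOfEmb κ ι (m + 1) :=
    localLayerSubgroupOfEmb_antitone κ ι (Nat.le_succ _)
  have h := Subgroup.relIndex_mul_index hle
  rw [index_localLayerSubgroupOfEmb_eq_pow_of_isTopGenerator κ ι hg,
    index_localLayerSubgroupOfEmb_eq_pow_of_isTopGenerator κ ι hg] at h
  exact Nat.eq_of_mul_eq_mul_right (pow_pos (Fact.out : p.Prime).pos (m + 1)) (by rw [h, pow_succ, mul_comm])

/-- (htr) is shift-invariant for `(p+1)`-torsion `η` of the base: `Tr_{m+2/m+1}(dH(m+2) + η) = −(dH m + η)`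
(`Tr η = p•η = −η`). At `p = 2`: `η ∈ W(ℚ_v)[3]`. [cite: Kobayashi2003, Def. 1.1, §8.4] -/
theorem shift_trace {g : Field.absoluteGaloisGroup E} (hg : κ.IsTopGenerator (resGalOfEmb ι g))
    {dH : ℕ → localPoints W E} {η : localPoints W E}
    (htr : ∀ m, localTraceOfEmb κ ι W (m + 1) (m + 2) (dH (m + 2)) = -dH m)
    (hη : η ∈ localLayerPointsOfEmb κ ι W 0) (hη' : (p + 1) • η = 0) (m : ℕ) :
    localTraceOfEmb κ ι W (m + 1) (m + 2) (dH (m + 2) + η) = -(dH m + η) := by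
  have hp : p • η = -η := by
    rw [succ_nsmul] at hη'
    exact eq_neg_of_add_eq_zero_left hη'
  rw [map_add, htr m, localTraceOfEmb_succ_succ_of_mem_zero κ ι W hg hη m, hp, neg_add]

/-- (hndiv) is shift-invariant: `dH 0 ∉ p·E(E)` ⟹ `dH 0 + η ∉ p·E(E)` (`dH 0 + η = p•b` would give
`dH 0 = p•(b + η)`). [cite: Kobayashi2003, §8.4 (GEN₀)] -/
theorem shift_ndiv {dH : ℕ → localPoints W E} {η : localPoints W E}
    (hndiv : ∀ b ∈ localLayerPointsOfEmb κ ι W 0, dH 0 ≠ p • b)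
    (hη : η ∈ localLayerPointsOfEmb κ ι W 0) (hη' : (p + 1) • η = 0) :
    ∀ b ∈ localLayerPointsOfEmb κ ι W 0, dH 0 + η ≠ p • b := by
  intro b hb h
  have hp : p • η = -η := by
    rw [succ_nsmul] at hη'
    exact eq_neg_of_add_eq_zero_left hη'
  refine hndiv (b + η) (add_mem hb hη) ?_
  rw [smul_add, hp, ← h, add_neg_cancel_right]

/-- The `g`-translates of the shifted datum stay in the tower points. [cite: Sprung2012, Def. 3.1] -/
theorem shift_hdA {g : Field.absoluteGaloisGroup E} {dH : ℕ → localPoints W E} {η : localPoints W E}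
    (hdA : ∀ m j, g ^ j • dH m ∈ localTowerPointsOfEmb κ ι W)
    (hη : η ∈ localLayerPointsOfEmb κ ι W 0) (m j : ℕ) :
    g ^ j • (dH m + η) ∈ localTowerPointsOfEmb κ ι W := by
  rw [smul_add]
  exact add_mem (hdA m j)
    (smul_mem_localTowerPointsOfEmb κ ι W _ (localLayerPointsOfEmb_le_localTowerPointsOfEmb κ ι W 0 hη))

/-- Every `ℤ_p`-valued functional of the tower points takes the SAME value on `gʲ•(dH m + η)` and on `gʲ•dH m`
(`gʲ•η` is `(p+1)`-torsion). Hence the pairing sums in (5) and (6) — and the relay's `P⃗_{2m}(z)` — are literally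
unchanged by the shift. [folklore] -/
theorem shift_apply_eq {g : Field.absoluteGaloisGroup E} {dH : ℕ → localPoints W E} {η : localPoints W E}
    (hdA : ∀ m j, g ^ j • dH m ∈ localTowerPointsOfEmb κ ι W)
    (hη : η ∈ localLayerPointsOfEmb κ ι W 0) (hη' : (p + 1) • η = 0)
    (z : ↥(localTowerPointsOfEmb κ ι W) →+ ℤ_[p]) (m j : ℕ) :
    z ⟨g ^ j • (dH m + η), shift_hdA κ ι W hdA hη m j⟩ = z ⟨g ^ j • dH m, hdA m j⟩ := by
  have hηT : g ^ j • η ∈ localTowerPointsOfEmb κ ι W :=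
    smul_mem_localTowerPointsOfEmb κ ι W _ (localLayerPointsOfEmb_le_localTowerPointsOfEmb κ ι W 0 hη)
  have hsplit : (⟨g ^ j • (dH m + η), shift_hdA κ ι W hdA hη m j⟩ : ↥(localTowerPointsOfEmb κ ι W)) =
      ⟨g ^ j • dH m, hdA m j⟩ + ⟨g ^ j • η, hηT⟩ := by
    ext; simp [smul_add]
  have htor : (p + 1) • (⟨g ^ j • η, hηT⟩ : ↥(localTowerPointsOfEmb κ ι W)) = 0 := by
    ext; simp [← smul_comm, hη']
  rw [hsplit, map_add, apply_eq_zero_of_succ_nsmul_eq_zero z htor, add_zero]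

/-- The pairing SUM of (5)/(6) is shift-invariant (coefficient by coefficient). [cite: Kobayashi2003, (8.23)] -/
theorem shift_pairingSum_eq {g : Field.absoluteGaloisGroup E} {dH : ℕ → localPoints W E} {η : localPoints W E}
    (hdA : ∀ m j, g ^ j • dH m ∈ localTowerPointsOfEmb κ ι W)
    (hη : η ∈ localLayerPointsOfEmb κ ι W 0) (hη' : (p + 1) • η = 0)
    (z : ↥(localTowerPointsOfEmb κ ι W) →+ ℤ_[p]) (m N : ℕ) :
    (∑ j ∈ range N, C (z ⟨g ^ j • (dH m + η), shift_hdA κ ι W hdA hη m j⟩) * (X + 1) ^ j : ℤ_[p][X]) =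
      ∑ j ∈ range N, C (z ⟨g ^ j • dH m, hdA m j⟩) * (X + 1) ^ j :=
  sum_congr rfl fun j _ => by rw [shift_apply_eq κ ι W hdA hη hη' z m j]

/-- **THE SHIFT CERTIFICATE in the shape of `OnePairPins.hcol` / the relay's `hMT` binders** (layers `2m`, a sign family
`S m`, moduli `Ω m`, ANY map `col` on functionals — instantiate `Ω m := ω_{2m}`, `S m := (−1)^m ω⁻_{2m}`): if `(g, dH)` satisfies
(hlay)(htr)(hndiv)(5)(6) then so does `(g, dH + η)` for every `(p+1)`-torsion point `η` of the base. So «admitted by the pin»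
does NOT imply «formal»: (BKρ) (`KatoBKCoord`, formal points only) cannot be applied to the handed datum as such.
[cite: Kobayashi2003, Def. 1.1, Thm. 6.2, (8.23), §8.4] [cite: SilvermanAEC2009, VII.2 Prop. 2.1] -/
theorem shift_admissible {g : Field.absoluteGaloisGroup E} (hg : κ.IsTopGenerator (resGalOfEmb ι g))
    {dH : ℕ → localPoints W E} {η : localPoints W E}
    (hdA : ∀ m j, g ^ j • dH m ∈ localTowerPointsOfEmb κ ι W)
    (hd : ∀ m, dH m ∈ localLayerPointsOfEmb κ ι W m)
    (htr : ∀ m, localTraceOfEmb κ ι W (m + 1) (m + 2) (dH (m + 2)) = -dH m)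
    (hndiv : ∀ b ∈ localLayerPointsOfEmb κ ι W 0, dH 0 ≠ p • b)
    (Ω S : ℕ → PowerSeries ℤ_[p]) (col : (↥(localTowerPointsOfEmb κ ι W) →+ ℤ_[p]) → PowerSeries ℤ_[p])
    (hcong : ∀ (z : ↥(localTowerPointsOfEmb κ ι W) →+ ℤ_[p]) (m : ℕ),
      Ω m ∣ ((∑ j ∈ range (p ^ (2 * m)), C (z ⟨g ^ j • dH (2 * m), hdA (2 * m) j⟩) * (X + 1) ^ j : ℤ_[p][X]) :
        PowerSeries ℤ_[p]) + S m * col z)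
    (hpin : ∀ (z : ↥(localTowerPointsOfEmb κ ι W) →+ ℤ_[p]) (L : PowerSeries ℤ_[p]),
      (∀ m : ℕ, Ω m ∣ ((∑ j ∈ range (p ^ (2 * m)), C (z ⟨g ^ j • dH (2 * m), hdA (2 * m) j⟩) * (X + 1) ^ j : ℤ_[p][X]) :
        PowerSeries ℤ_[p]) + S m * L) → L = col z)
    (hη : η ∈ localLayerPointsOfEmb κ ι W 0) (hη' : (p + 1) • η = 0) :
    (∀ m, dH m + η ∈ localLayerPointsOfEmb κ ι W m) ∧
    (∀ m, localTraceOfEmb κ ι W (m + 1) (m + 2) (dH (m + 2) + η) = -(dH m + η)) ∧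
    (∀ b ∈ localLayerPointsOfEmb κ ι W 0, dH 0 + η ≠ p • b) ∧
    (∀ (z : ↥(localTowerPointsOfEmb κ ι W) →+ ℤ_[p]) (m : ℕ),
      Ω m ∣ ((∑ j ∈ range (p ^ (2 * m)), C (z ⟨g ^ j • (dH (2 * m) + η), shift_hdA κ ι W hdA hη (2 * m) j⟩) * (X + 1) ^ j :
        ℤ_[p][X]) : PowerSeries ℤ_[p]) + S m * col z) ∧
    (∀ (z : ↥(localTowerPointsOfEmb κ ι W) →+ ℤ_[p]) (L : PowerSeries ℤ_[p]),
      (∀ m : ℕ, Ω m ∣ ((∑ j ∈ range (p ^ (2 * m)), C (z ⟨g ^ j • (dH (2 * m) + η), shift_hdA κ ι W hdA hη (2 * m) j⟩) *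
        (X + 1) ^ j : ℤ_[p][X]) : PowerSeries ℤ_[p]) + S m * L) → L = col z) := by
  refine ⟨shift_mem_localLayerPointsOfEmb κ ι W hd hη, shift_trace κ ι W hg htr hη hη', shift_ndiv κ ι W hndiv hη hη',
    fun z m => ?_, fun z L hL => hpin z L fun m => ?_⟩
  · rw [shift_pairingSum_eq κ ι W hdA hη hη' z (2 * m) (p ^ (2 * m))]
    exact hcong z m
  · rw [← shift_pairingSum_eq κ ι W hdA hη hη' z (2 * m) (p ^ (2 * m))]
    exact hL m

omit [Fact p.Prime] in
/-- NON-FORMALITY of the shifted datum: if `F` («formal points») has no `(p+1)`-torsion, `dH m ∈ F` and `η ≠ 0` is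
`(p+1)`-torsion, then `dH m + η ∉ F`. [cite: SilvermanAEC2009, VII.2 Prop. 2.1, VII.3 Prop. 3.1] -/
theorem shift_not_mem {M : Type*} [AddCommGroup M] (F : AddSubgroup M)
    (hF : ∀ x ∈ F, (p + 1) • x = 0 → x = 0) {d η : M} (hd : d ∈ F) (hη' : (p + 1) • η = 0) (hη0 : η ≠ 0) :
    d + η ∉ F := fun h =>
  hη0 (hF η (by simpa using F.sub_mem h hd) hη')

end Shift

/-! ## §2 Rigidity: one column, one pairing polynomial -/

section Rigidity

variable {R : Type*} [CommRing R]

/-- Two congruences `ω ∣ P₁ + s·L₁`, `ω ∣ P₂ + s·L₂` and `L₂ = u·L₁` give `ω ∣ P₂ − u·P₁`. [folklore] -/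
theorem dvd_sub_mul_of_congr_pair {ω s P₁ P₂ L₁ L₂ u : R} (h₁ : ω ∣ P₁ + s * L₁) (h₂ : ω ∣ P₂ + s * L₂)
    (hu : L₂ = u * L₁) : ω ∣ P₂ - u * P₁ := by
  have h : P₂ - u * P₁ = (P₂ + s * L₂) - u * (P₁ + s * L₁) := by rw [hu]; ring
  rw [h]
  exact dvd_sub h₂ (dvd_mul_of_dvd_right h₁ u)

/-- Same column (`u = 1`): `ω ∣ P₂ − P₁`. [folklore] -/
theorem dvd_sub_of_congr_pair {ω s P₁ P₂ L : R} (h₁ : ω ∣ P₁ + s * L) (h₂ : ω ∣ P₂ + s * L) : ω ∣ P₂ - P₁ := by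
  simpa using dvd_sub_mul_of_congr_pair (u := 1) h₁ h₂ (one_mul L).symm

variable {p : ℕ} [Fact p.Prime]

/-- **RIGIDITY.** Two Honda data admitted by the SAME plus Coleman value `L` (conjunct (5) of `OnePairPins.hcol` for a
fixed functional `z` and layer) have EQUAL pairing values `z(gʲ•d_{(n)}) = z(gʲ•d'_{(n)})`, `j < pⁿ`: the difference of
the two sums has degree `< pⁿ` and is divisible by the distinguished `ω_n` (Washington Prop. 7.2, landed as
`Sprung2012.eq_zero_of_toIwasawa_cyclotomicOmega_dvd_sum`). So the relay's `hMT` «for every admitted datum» is `hMT` at the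
hidden datum. [cite: Washington1997, Prop. 7.2] [cite: Kobayashi2003, Thm. 6.2, (8.23)] -/
theorem pairingValues_eq_of_congr_pair {n : ℕ} (a b : ℕ → ℤ_[p]) {s L : PowerSeries ℤ_[p]}
    (ha : toIwasawa p (cyclotomicOmega p n) ∣ (∑ j ∈ range (p ^ n), PowerSeries.C (a j) * (1 + PowerSeries.X) ^ j) + s * L)
    (hb : toIwasawa p (cyclotomicOmega p n) ∣ (∑ j ∈ range (p ^ n), PowerSeries.C (b j) * (1 + PowerSeries.X) ^ j) + s * L)
    {j : ℕ} (hj : j < p ^ n) : a j = b j := by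
  have hd := dvd_sub_of_congr_pair hb ha
  have hre : ((∑ j ∈ range (p ^ n), PowerSeries.C (a j) * (1 + PowerSeries.X) ^ j) -
      ∑ j ∈ range (p ^ n), PowerSeries.C (b j) * (1 + PowerSeries.X) ^ j) =
      ∑ j ∈ range (p ^ n), PowerSeries.C (a j - b j) * (1 + PowerSeries.X) ^ j := by
    rw [← sum_sub_distrib]
    exact sum_congr rfl fun j _ => by rw [map_sub, sub_mul]
  rw [hre] at hd
  exact sub_eq_zero.mp (eq_zero_of_toIwasawa_cyclotomicOmega_dvd_sum (fun j => a j - b j) hd hj)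

end Rigidity

/-! ## §3 Torsor bypass: the Mazur–Tate congruence moves along `col' = u·col` -/

section Transfer

variable {R A : Type*} [CommRing R] [CommRing A]

/-- Coordinatewise `ω ∣ t₁ i − u·t₂ i` pushed through an additive `Λ`-semilinear `e` (the relay's binder `he`):
`φ ω ∣ e t₁ − φ u · e t₂`. [folklore] -/
theorem map_dvd_sub_of_forall_dvd {ι : Type*} (φ : R →+* A) (e : (ι → R) →+ A)
    (he : ∀ (r : R) (t : ι → R), e (r • t) = φ r * e t) {ω u : R} {t₁ t₂ : ι → R}
    (h : ∀ i, ω ∣ t₁ i - u * t₂ i) : φ ω ∣ e t₁ - φ u * e t₂ := by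
  choose c hc using h
  have ht : t₁ - u • t₂ = ω • c := funext fun i => by simpa [Pi.smul_apply, smul_eq_mul] using hc i
  refine ⟨e c, ?_⟩
  rw [← he u t₂, ← he ω c, ← ht, map_sub]

/-- **MTV TRANSFER (cleared form, the relay's shape).** From the Mazur–Tate congruence along datum 1,
`c·(μ·θ − ν·w·E₁) = ω·q`, and the torsor relation `E₁ − U·E₂ = ω·r` (from (5) along both data and `col₁ = u·col₂`,
`U = e`-image of `u`), the congruence along datum 2 holds with the unit `w·U` and NO inverse:
`c·(μ·θ − ν·(w·U)·E₂) = ω·(q + c·ν·w·r)`. [cite: Kato2004Asterisque, Thm. 12.5 (1)] [cite: Kobayashi2003, Thm. 6.2] -/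
theorem mtCongr_transfer {c μ θ ν w E₁ E₂ U ω q r : A}
    (h₁ : c * (μ * θ - ν * w * E₁) = ω * q) (h₂ : E₁ - U * E₂ = ω * r) :
    c * (μ * θ - ν * (w * U) * E₂) = ω * (q + c * ν * w * r) := by
  linear_combination h₁ + (c * ν * w) * h₂

/-- The transferred multiplier is again a unit. [folklore] -/
theorem isUnit_mul_transfer {w U : A} (hw : IsUnit w) (hU : IsUnit U) : IsUnit (w * U) := hw.mul hU

/-- Same column, two data (rigidity mod `ω`, `U = 1`): the Mazur–Tate congruence for one admitted datum is the
congruence for every admitted datum, with the SAME `(μ, ν, w)`. [folklore] -/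
theorem mtCongr_transfer_same {c μ θ ν w E₁ E₂ ω q r : A}
    (h₁ : c * (μ * θ - ν * w * E₁) = ω * q) (h₂ : E₁ - E₂ = ω * r) :
    c * (μ * θ - ν * w * E₂) = ω * (q + c * ν * w * r) := by
  linear_combination h₁ + (c * ν * w) * h₂

end Transfer

/-! ## §4 Toy certificates -/

section Toy

/-- `#W̃(𝔽₂) = 3` for the two trace-zero reductions `y² + y = x³ (+1)`: two affine points each (plus `O`), so the
`3`-torsion that shifts Honda data at `2` is there. [cite: SilvermanAEC2009, V.1, VII.2 Prop. 2.1] -/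
theorem toy_affine_count_trace_zero :
    (Finset.univ.filter fun P : ZMod 2 × ZMod 2 => P.2 ^ 2 + P.2 = P.1 ^ 3).card = 2 ∧
    (Finset.univ.filter fun P : ZMod 2 × ZMod 2 => P.2 ^ 2 + P.2 = P.1 ^ 3 + 1).card = 2 := by
  decide

/-- At `p = 2` the relevant torsion order is `p + 1 = 3` and the generator of the Iwasawa variable is
`cyclotomicGenerator 2 = 5` (so `(X+1)^s ↔ 5^s` in `mazurTateElementK`, matching `(VALρ)`'s `ψ(5)`). [folklore] -/
theorem toy_constants_two : cyclotomicGenerator 2 = 5 ∧ torsionOrder 2 = 2 ∧ (2 + 1 = 3) := by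
  refine ⟨rfl, ?_, rfl⟩
  decide

end Toy

end Summit.BirchSwinnertonDyer.BirchSwinnertonDyer.Cruxes.ResidualThetaCountLowerPureAtTwo.SideaK4G24
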